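import Summits.BirchSwinnertonDyer.Rank1Residual.Additive.FouquetWanLocus
import Summits.BirchSwinnertonDyer.BirchSwinnertonDyer.Theorems.AdditiveKolyvaginRoadLevelDefs
import Literature.NumberTheory.Automorphic.BrandtGrossPoints
import Literature.NumberTheory.Automorphic.BrandtEigenLine
import Literature.NumberTheory.EllipticCurves.CuspFormLFunction
import HarnessLib

/-!
# Route `SignedBaseChange`, crux `AnticyclotomicEisensteinDivisibility` (stmt-BirchSwinnertonDyer-20727), line `admdef` v23: the TWO registered
# research texts of the line — the rank-0 DEFINITE ANCHOR on cell β, cut by the Fouquet–Wan locus — as `@[conjecture]` CONSTANTS BY NAME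

LEAD seat bsd-line-sbc-p1 (gen 31), `--supports stmt-BirchSwinnertonDyer-20727`, acting on director-bsd ruling (543)(a) 2026-08-30 («promote the
registered stub `stub_definiteAnchorNFW` (K1, HARDEST, unsourced) to a route ITEM … signature = the registered stub text VERBATIM … or BY-NAME via
a LEAD-landed `Theorems/SignedBaseChangeDefiniteAnchorDefs.lean`»).  Theses-free definitions module (pattern of `ByReductionTypeAtTwoMultKatoInputsDefs.lean`):
TWO `@[conjecture] def … : Prop` constants whose BODIES are, token for token, the bodies of `AdmdefLine.DefiniteAnchorFWNS` and
`AdmdefLine.DefiniteAnchorNFWNS` of the skeleton of record `Cruxes/AnticyclotomicEisensteinDivisibility/Lines/admdef.lean` (v23, sha16 0da8f8faa6cd709b,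
registered stubs `stub_definiteAnchorFW : DefiniteAnchorFWNS` and `stub_definiteAnchorNFW : DefiniteAnchorNFWNS`) — so that (i) the planner pen can file
the K1 item BY NAME (`def <Decl> : Prop := SignedBaseChangeDefiniteAnchorDefs.DefiniteAnchorNonFW` under ONE import of the route file), and (ii) the
next skeleton (v24) can re-key its two anchor stubs to these names by `Iff.rfl` certificates.  NOTHING is asserted; no theorem; no instance; no
notation.  Both constants are RESEARCH statements (rank-0 mod-`p` converse theorems for non-ordinary level-raised definite forms at non-square-free
level), NOT published results: `DefiniteAnchorFW` is PREPRINT-sourced on its locus (Fouquet–Wan 2021 Thm. 5.1 ∕ Cor. 1.10 ×2, modulo the untyped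
ports T1–T4 of `Lines/admdef-lead-g23.md` §4); `DefiniteAnchorNonFW` (= K1) has NO source (Fouquet–Wan's third hypothesis fails, SU14 needs ordinary,
CÇSS18 ∕ BSTW24 need square-free ∕ semistable level, CLW22 needs a `ρ̄`-ramified non-split `q`).  BSD ∕ the crux ∕ these constants are NOT proved
by this file; no summit statement is proved.

THE STATEMENT (both constants; they differ only in the Fouquet–Wan binder).  Cell β: `E/ℚ` elliptic, globally minimal `W`, newform `f` of level
`N` with `(N : ℤ) = N_E`, `p ≥ 5` of good reduction with `a_p = 0`, `ρ̄_{E,p}` onto (`Rank1Residual.Surj`), `K` imaginary quadratic with `p` split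
and every `ℓ ∣ N` split, `(N, d_K) = 1`, `p ∤ h_K`, `N` NOT square-free (i), `E[p]` ramified at every prime `q ∣ N` (ii); PLUS the Fouquet–Wan
binder `Rank1Residual.Additive.FWNonsplitRam W p` (some non-split multiplicative `q ≠ p` with `p ∤ v_q(Δ_min)`) for `DefiniteAnchorFW`, resp. its
NEGATION for `DefiniteAnchorNonFW`.  Conclusion (Anch): for every non-trivial `c ∈ Aut(K/ℚ)`, every `𝔽_p`-structure on `H¹(K, E[p])`
(`AdditiveKoly.Vp`) and every finite set `n` of Bertolini–Darmon `1`-admissible primes (`AdditiveKoly.AdmQ`) of ODD cardinality at which BOTH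
`c`-eigenspaces of the level-raised `p`-Selmer group vanish (`AdditiveKoly.SelQP W K p c n μ = ⊥`, the AKR currency of W. Zhang's `Sel_n`), there are
a definite Brandt set-up `S : Brandt.XiSetup N (∏ n)` (quaternion algebra of discriminant `∏ n`, Eichler order of level `N`), a Gross point `(ψ, I)` of
`K` and a mod-`p` Brandt eigenvector `φ` off the level `N·∏ n` for the Hecke eigenvalues `a_ℓ(E)` whose WEIGHTED toric period
`Σ_i w_i φ(i)`-pairing against the Gross point is NON-ZERO mod `p`.  In print currency: the rank-0 mod-`℘` converse for the level-raised definite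
forms `g_n`, `g_n ⊗ χ_K` at a Selmer-zero vertex (CHKLL25 Thm. 7.6 WITHOUT its square-free hypothesis; Gross's special-value formula mod `℘` with the
weighted period; multiplicity one mod `p`, Kim–Ota 2023).

[cite: CastellaEtAl2025, Thm. 7.6, §7.4, Thm. 7.5 (arXiv:2308.10474v2 pp. 31–33)] [cite: FouquetWan2021, Thm. 5.1, Cor. 1.10, Thm. 1.7 (arXiv:2107.13726v3 pp. 5–6, 53)]
[cite: WZhang2014, Prop. 5.4, Thm. 5.2, Thm. 7.2, Thm. 9.1] [cite: KimOta2023, Thm. 1.3, Cor. 5.7] [cite: Gross1987, Prop. 10.3, §11]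
[cite: BertoliniDarmon2005, Thm. 5.15, §9] [cite: SkinnerUrban2014, Thm. 3.29] [cite: BurungaleSkinnerTianWan2024, Thm. 1.5–1.6 (arXiv:2409.01350)]
-/

-- D-0017: single-problem summit, the namespace repeats the problem name by design.
set_option linter.dupNamespace false
set_option autoImplicit false

noncomputable section

open scoped Classical NumberField Pointwise

open NumberField IsDedekindDomain Field
  Literature.NumberTheory.EllipticCurves Literature.NumberTheory.EllipticCurves.ModularForms
  Literature.NumberTheory.EllipticCurves.Rank1Residual Literature.NumberTheory.GaloisRepresentations
  Literature.NumberTheory.Automorphic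
  Summit.BirchSwinnertonDyer.BirchSwinnertonDyer.Theorems

namespace Summit.BirchSwinnertonDyer.BirchSwinnertonDyer.Theorems.SignedBaseChangeDefiniteAnchorDefs

/-- **(Anch)_FW — the registered text of `stub_definiteAnchorFW` of `Lines/admdef.lean` v23 (body of `AdmdefLine.DefiniteAnchorFWNS`, VERBATIM)**:
on cell β (see the module docstring for every binder) AND on the FOUQUET–WAN LOCUS `Rank1Residual.Additive.FWNonsplitRam W p`, at EVERY odd zero
vertex `n` of the level-raised Selmer walk (`AdditiveKoly.SelQP W K p c n μ = ⊥` for both signs `μ`), Brandt data at level `N·∏ n` — a definite set-up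
`S : Brandt.XiSetup N (∏ n)`, a Gross point `(ψ, I)` of `K`, a mod-`p` eigenvector `φ` off the level for `ℓ ↦ a_ℓ(E)` — with NON-ZERO WEIGHTED toric
period mod `p`.  RESEARCH statement, PREPRINT-sourced on this locus (Fouquet–Wan 2021 Thm. 5.1 ∕ Cor. 1.10 applied to `g_n` and `g_n ⊗ χ_K`, whose
Steinberg prime is `E`'s own `ρ̄`-ramified non-split `q`, split in `K`) MODULO the untyped ports T1–T4 (level raising, Gross's formula mod `℘` with
the weighted period, multiplicity one mod `p`, control at the zero vertex).  Nothing asserted.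
[cite: FouquetWan2021, Thm. 5.1, Cor. 1.10, Thm. 1.7 (arXiv:2107.13726v3 pp. 5–6, 53)] [cite: CastellaEtAl2025, Thm. 7.6, §7.4 (arXiv:2308.10474v2 pp. 31–33)]
[cite: WZhang2014, Prop. 5.4, Thm. 5.2, Thm. 7.2, Thm. 9.1] [cite: KimOta2023, Thm. 1.3, Cor. 5.7] [cite: Gross1987, Prop. 10.3, §11] -/
@[conjecture] def DefiniteAnchorFW : Prop :=
  ∀ {p : ℕ} [Fact p.Prime] (W : WeierstrassCurve ℚ) [W.IsElliptic] [W.IsGloballyMinimal]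
    (K : Type) [Field K] [NumberField K] {N : ℕ} [NeZero N] {f : CuspForm (CongruenceSubgroup.Gamma0 N) 2}
    (_ : IsNewformOf W f),
    (N : ℤ) = W.conductorNorm ℤ → 5 ≤ p → W.HasGoodReductionAtPrime p → W.frobeniusTrace p = 0 →
    Surj W p →
    IsImaginaryQuadratic K → ((Ideal.span {(p : ℤ)}).primesOver (𝓞 K)).ncard = 2 →
    (∀ ℓ : ℕ, ℓ.Prime → ℓ ∣ N → ((Ideal.span {(ℓ : ℤ)}).primesOver (𝓞 K)).ncard = 2) →
    IsCoprime (N : ℤ) (NumberField.discr K) → ¬ p ∣ NumberField.classNumber K →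
    -- (i) NEGATED: `N` is NOT square-free
    ¬ Squarefree N →
    -- (ii): `E[p]` ramified at every prime `q ∣ N`
    (∀ q : ℕ, q.Prime → q ∣ N →
      ∃ v : HeightOneSpectrum (𝓞 ℚ), ((q : ℕ) : 𝓞 ℚ) ∈ v.asIdeal ∧
        ∃ 𝔓 ∈ v.primesAbove, ∃ σ ∈ 𝔓.inertia (absoluteGaloisGroup ℚ),
          ∃ P : W.geomTorsion (p : ℤ), σ • P ≠ P) →
    -- [v23] the FOUQUET–WAN LOCUS: some non-split multiplicative `q ≠ p` with `E[p]` ramified — FW21's Steinberg prime for every `g_n`, `g_n ⊗ χ_K`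
    Summit.BirchSwinnertonDyer.Rank1Residual.Additive.FWNonsplitRam W p →
    -- (Anch): at every ODD ZERO VERTEX of the level-raised Selmer walk, Brandt data with a non-zero mod-p WEIGHTED toric period [v14] — (Anch), v7 text
    ∀ (c : K ≃ₐ[ℚ] K), c ≠ 1 → ∀ [Module (ZMod p) (AdditiveKoly.Vp W K p)],
      ∀ n : Finset (AdditiveKoly.AdmQ W K p), Odd n.card → (∀ μ : Bool, AdditiveKoly.SelQP W K p c n μ = ⊥) →
        ∃ (S : Brandt.XiSetup N (∏ q ∈ n.image Subtype.val, q)) (ψ : K →ₐ[ℚ] S.D) (I : Submodule ℤ S.D)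
          (φ : Brandt.ClassSet S.O → ZMod p),
          Brandt.IsGrossPoint S.O ψ I ∧
          (letI : Fintype (Brandt.ClassSet S.O) := Fintype.ofFinite _
           φ ∈ Brandt.eigenSpace (ZMod p) (N * ∏ q ∈ n.image Subtype.val, q) (Brandt.matrix S.O) (fun ℓ ↦ W.frobeniusTrace ℓ)) ∧
          Brandt.toricPeriod S.O ψ I (fun i ↦ (Brandt.weight S.O i : ZMod p) * φ i) ≠ 0

/-- **(Anch)_¬FW = K1 — the registered text of `stub_definiteAnchorNFW` of `Lines/admdef.lean` v23 (body of `AdmdefLine.DefiniteAnchorNFWNS`, VERBATIM;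
the HARDEST stub)**: the same conclusion on cell β OFF the Fouquet–Wan locus (`¬ Rank1Residual.Additive.FWNonsplitRam W p`: on β this forces every
multiplicative prime of `E` to be SPLIT; it contains the multiplicative-free part of β and matches cell α's K1 binders).  UNSOURCED research
statement: the rank-0 mod-`℘` converse ∕ Eisenstein lower bound for the NON-ORDINARY level-raised definite forms `g_n`, `g_n ⊗ χ_K` whose level has NO
`ρ̄`-ramified non-split Steinberg prime — Fouquet–Wan 2021 Thm. 5.1's third hypothesis fails (admissible primes are `ρ̄`-unramified; `E`'s multiplicative
primes are split), Skinner–Urban needs ordinary, CÇSS18 ∕ BSTW24 need square-free ∕ semistable level, CLW22 needs a ramified non-split `q`.  This is the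
constant the director's ruling (543)(a) asks the planner pen to promote to a route item (by name).  Nothing asserted.
[cite: CastellaEtAl2025, Thm. 7.6, §7.4 (arXiv:2308.10474v2 pp. 31–33)] [cite: FouquetWan2021, Thm. 5.1 (third hypothesis), Cor. 1.10]
[cite: SkinnerUrban2014, Thm. 3.29] [cite: BurungaleSkinnerTianWan2024, Thm. 1.5–1.6 (arXiv:2409.01350)] [cite: WZhang2014, Thm. 9.1] -/
@[conjecture] def DefiniteAnchorNonFW : Prop :=
  ∀ {p : ℕ} [Fact p.Prime] (W : WeierstrassCurve ℚ) [W.IsElliptic] [W.IsGloballyMinimal]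
    (K : Type) [Field K] [NumberField K] {N : ℕ} [NeZero N] {f : CuspForm (CongruenceSubgroup.Gamma0 N) 2}
    (_ : IsNewformOf W f),
    (N : ℤ) = W.conductorNorm ℤ → 5 ≤ p → W.HasGoodReductionAtPrime p → W.frobeniusTrace p = 0 →
    Surj W p →
    IsImaginaryQuadratic K → ((Ideal.span {(p : ℤ)}).primesOver (𝓞 K)).ncard = 2 →
    (∀ ℓ : ℕ, ℓ.Prime → ℓ ∣ N → ((Ideal.span {(ℓ : ℤ)}).primesOver (𝓞 K)).ncard = 2) →
    IsCoprime (N : ℤ) (NumberField.discr K) → ¬ p ∣ NumberField.classNumber K →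
    -- (i) NEGATED: `N` is NOT square-free
    ¬ Squarefree N →
    -- (ii): `E[p]` ramified at every prime `q ∣ N`
    (∀ q : ℕ, q.Prime → q ∣ N →
      ∃ v : HeightOneSpectrum (𝓞 ℚ), ((q : ℕ) : 𝓞 ℚ) ∈ v.asIdeal ∧
        ∃ 𝔓 ∈ v.primesAbove, ∃ σ ∈ 𝔓.inertia (absoluteGaloisGroup ℚ),
          ∃ P : W.geomTorsion (p : ℤ), σ • P ≠ P) →
    -- [v23] OFF the Fouquet–Wan locus (UNSOURCED half = K1)
    ¬ Summit.BirchSwinnertonDyer.Rank1Residual.Additive.FWNonsplitRam W p →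
    -- (Anch): at every ODD ZERO VERTEX of the level-raised Selmer walk, Brandt data with a non-zero mod-p WEIGHTED toric period [v14] — (Anch), v7 text
    ∀ (c : K ≃ₐ[ℚ] K), c ≠ 1 → ∀ [Module (ZMod p) (AdditiveKoly.Vp W K p)],
      ∀ n : Finset (AdditiveKoly.AdmQ W K p), Odd n.card → (∀ μ : Bool, AdditiveKoly.SelQP W K p c n μ = ⊥) →
        ∃ (S : Brandt.XiSetup N (∏ q ∈ n.image Subtype.val, q)) (ψ : K →ₐ[ℚ] S.D) (I : Submodule ℤ S.D)
          (φ : Brandt.ClassSet S.O → ZMod p),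
          Brandt.IsGrossPoint S.O ψ I ∧
          (letI : Fintype (Brandt.ClassSet S.O) := Fintype.ofFinite _
           φ ∈ Brandt.eigenSpace (ZMod p) (N * ∏ q ∈ n.image Subtype.val, q) (Brandt.matrix S.O) (fun ℓ ↦ W.frobeniusTrace ℓ)) ∧
          Brandt.toricPeriod S.O ψ I (fun i ↦ (Brandt.weight S.O i : ZMod p) * φ i) ≠ 0

end Summit.BirchSwinnertonDyer.BirchSwinnertonDyer.Theorems.SignedBaseChangeDefiniteAnchorDefs

end
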